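import Summits.ResolutionOfSingularities.ResolutionOfSingularities.Theorems.WeightedInvariantWeightedThesisSeparableProjectionForms

/-!
# `WeightedInvariant.WeightedThesis`, line `datum-glued-split`, stub A (unconditional), II:
# separable projective Noether normalisation over a perfect field

Second of two files for the registered stub `stub_separableProjection` (crux `WeightedThesis`,
stmt-ResolutionOfSingularities-0569), PROVED here WITHOUT Kedlaya's theorem: for an integral closed
`X ⊆ ℙⁿ_k` over a PERFECT field `k` of characteristic `p` (possibly finite) there is a finite
surjective `k`-morphism `ψ : X → ℙ^d_k`, `d = dim X`, along which `K(X) / K(ℙ^d)` is finite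
SEPARABLE.

Proof. By file I (`SeparableProjection.exists_forms`) there are forms `g₁, …, g_d` of degrees `N_i`
prime to `p` such that `x_{j₀}, g₁, …, g_d` have no common zero on `X` and
`dφ(g₁), …, dφ(g_d)` are linearly independent in `Ω[K(X)⁄k]` (of dimension `d = dim X`,
`functionFieldKaehler`), `φ(G) = G(x/x_{j₀})`. With `M = ∏ N_i = a_i N_i` the forms
`x_{j₀}^M, g_1^{a_1}, …, g_d^{a_d}` of degree `M` have no common zero, so the rational map
`(1 : φ(g₁)^{a₁} : … : φ(g_d)^{a_d})` is a morphism `ψ : X → ℙ^d` (`Resolution.toProjOfVec`) with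
affine charts `X_{g_i}` (`lsChart_eq_ZH`), hence finite (`X` is proper), surjective by dimension,
and the `ψ^♯(y_i/y₀) = φ(g_i)^{a_i}`
(`GeneratingSections.functionFieldMap_toProj_awayToFunctionField_frac`) have independent
differentials `a_i φ(g_i)^{a_i - 1} dφ(g_i)` (`a_i` is prime to `p`), whence `K(X) / K(ℙ^d)` is
finite separable (`isSeparable_of_linearIndependent`).

## References

* D. Eisenbud, *Commutative Algebra with a View Toward Algebraic Geometry* (1995), Cor. 16.18
  (separable Noether normalisation over a perfect field). [Eisenbud1995]
* K. S. Kedlaya, *More étale covers of affine spaces in positive characteristic*, J. Algebraic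
  Geom. 14 (2005), Thm. 1 (a stronger statement; not used). [Kedlaya2004]
-/

noncomputable section

set_option linter.dupNamespace false -- mandated namespace of this single-conjunct summit

open CategoryTheory AlgebraicGeometry TopologicalSpace Topology Opposite HomogeneousLocalization
open Literature.AlgebraicGeometry.Morphisms.ProjCech (grading PP)
open Literature.AlgebraicGeometry.Motives Literature.AlgebraicGeometry.Motives.ProjFrac
open Literature.AlgebraicGeometry.Motives.RatFn Literature.AlgebraicGeometry.Resolution
open Literature.Topology
open Literature.AlgebraicGeometry.Resolution.LinSec (j₀ genericPoint_mem_chart_j₀)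

namespace Summit.ResolutionOfSingularities.ResolutionOfSingularities.Theorems.WeightedThesis.HypersurfaceModel

namespace SeparableProjection

universe u

variable {k : Type u} [Field k] {n : ℕ} {X : Scheme.{u}} [IsIntegral X] (ι : X ⟶ PP k n)

/-! ## The finite separable projection -/

/-- **Separable projective Noether normalisation over a perfect field** (any universe): for an
integral closed `X ⊆ ℙⁿ_k`, `k` perfect of characteristic `p`, there is a finite surjective
`k`-morphism `ψ : X → ℙ^d_k`, `d = dim X`, with `K(X) / K(ℙ^d)` finite separable (the projective
analogue of Eisenbud's separable Noether normalisation, Cor. 16.18). See the module docstring for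
the proof. [folklore; cite: Eisenbud1995, Cor. 16.18] -/
theorem separableProjection [IsClosedImmersion ι] {p : ℕ} (hp : p.Prime) [CharP k p]
    [PerfectField k] :
    ∃ (d : ℕ) (ψ : X ⟶ ProjSpace.P d k) (_ : IsFinite ψ) (_ : Surjective ψ),
      ψ ≫ Segre.toSpec (Fin (d + 1)) k = ι ≫ Segre.toSpec (Fin (n + 1)) k ∧
      topologicalKrullDim X = d ∧
      ∀ [Algebra (ProjSpace.P d k).functionField X.functionField],
        algebraMap (ProjSpace.P d k).functionField X.functionField = functionFieldMap ψ →
        Algebra.IsSeparable (ProjSpace.P d k).functionField X.functionField ∧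
          Module.Finite (ProjSpace.P d k).functionField X.functionField := by
  classical
  -- `X` is proper over `k`, hence Noetherian; `K(X)` is a `k`-algebra (`RatFn.algebraStalk`)
  set f : X ⟶ Spec (.of k) := ι ≫ Segre.toSpec (Fin (n + 1)) k
  haveI : IsProper (Segre.toSpec (Fin (n + 1)) k) := ProjSpace.isProper_over n k
  haveI : IsProper f := inferInstance
  letI : X.Over (Spec (.of k)) := ⟨f⟩
  haveI : IsProper (X ↘ Spec (.of k)) := ‹IsProper f›
  haveI : IsNoetherian X := isNoetherian_of_isProper k X
  have halg : algebraMap k X.functionField = (X.presheaf.germ ⊤ (genericPoint X) trivial).hom.comp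
      (f.appTop.hom.comp (Scheme.ΓSpecIso (.of k)).inv.hom) := rfl
  -- `dim Ω[K(X)⁄k] = dim X = d`
  obtain ⟨hess, hΩ, d, hXd, hrank⟩ := FunctionFieldKaehler.functionFieldKaehler f halg
  haveI := hess
  haveI := hΩ
  -- the forms `g₁, …, g_d`: `x_{j₀}, g₁, …, g_d` have no common zero on `X`
  obtain ⟨N, g, hNg, hli, hZ⟩ := exists_forms ι halg hp.one_lt hrank hXd d le_rfl
  have hempty : {x : X | x ∉ LinSec.chart ι (LinSec.j₀ ι) ∧ ∀ j, x ∉ ZH ι (g j)} = ∅ :=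
    eq_empty_of_topologicalKrullDim_lt_zero (isClosed_base ι g) (by simpa using hZ)
  -- equalising the degrees: `M = ∏ N_j = a_j N_j`, `a_j` prime to `p`
  set a : Fin d → ℕ := fun j => ∏ j' ∈ Finset.univ.erase j, N j'
  set M : ℕ := ∏ j, N j
  have hMa : ∀ j, a j • N j = M := fun j => by
    rw [smul_eq_mul, mul_comm]; exact Finset.mul_prod_erase _ _ (Finset.mem_univ j)
  have hM0 : 0 < M := Finset.prod_pos fun j _ => (hNg j).1
  have ha0 : ∀ j, 0 < a j := fun j => Finset.prod_pos fun j' _ => (hNg j').1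
  have hpa : ∀ j, ¬ p ∣ a j := fun j h => by
    obtain ⟨j', -, hj'⟩ := (hp.prime.dvd_finsetProd_iff _).1 h
    exact (hNg j').2.1 hj'
  let H : Fin (d + 1) → MvPolynomial (Fin (n + 1)) k :=
    Fin.cons (MvPolynomial.X (LinSec.j₀ ι) ^ M) fun j => g j ^ a j
  have hH0 : H 0 = MvPolynomial.X (LinSec.j₀ ι) ^ M := rfl
  have hHs : ∀ j, H j.succ = g j ^ a j := fun j => rfl
  have hH : ∀ i, H i ∈ grading k n M := fun i => by
    refine Fin.cases ?_ (fun j => ?_) i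
    · rw [hH0]; simpa using SetLike.pow_mem_graded M (LinSec.X_mem (k := k) (LinSec.j₀ ι))
    · rw [hHs, ← hMa j]; exact SetLike.pow_mem_graded (a j) (hNg j).2.2
  have hcov : ∀ x : X, ∃ i, x ∈ ZH ι (H i) := fun x => by
    by_cases hx : x ∈ LinSec.chart ι (LinSec.j₀ ι)
    · exact ⟨0, by rw [hH0, ZH_pow ι _ hM0]; exact hx⟩
    · have hx' : x ∉ {x : X | x ∉ LinSec.chart ι (LinSec.j₀ ι) ∧ ∀ j, x ∉ ZH ι (g j)} := by
        rw [hempty]; exact id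
      simp only [Set.mem_setOf_eq, not_and, not_forall, not_not] at hx'
      obtain ⟨j, hj⟩ := hx' hx
      exact ⟨j.succ, by rw [hHs, ZH_pow ι _ (ha0 j)]; exact hj⟩
  -- the rational functions `z_i = φ(H_i)` and the morphism `ψ = (z₀ : … : z_d)`
  set z : Fin (d + 1) → X.functionField :=
    fun i => dehomFn ι (j₀ ι) (genericPoint_mem_chart_j₀ ι) (H i) with hz
  have hz0 : z 0 = 1 := by simp only [hz, hH0, map_pow, dehomFn_X_self, one_pow]
  have hzs : ∀ j, z j.succ = dehomFn ι (j₀ ι) (genericPoint_mem_chart_j₀ ι) (g j) ^ a j :=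
    fun j => by simp only [hz, hHs, map_pow]
  have hz00 : z 0 ≠ 0 := by rw [hz0]; exact one_ne_zero
  have hdef : ∀ x : X, IsDefinedAt z x := fun x =>
    let ⟨i, hi⟩ := hcov x; ⟨i, mem_lsChart_of_mem_ZH ι _ _ hM0 hH hi⟩
  set ψ := toProjOfVec z f hdef
  have hψf : ψ ≫ Segre.toSpec (Fin (d + 1)) k = f := toProjOfVec_toSpec z f hdef
  haveI : IsAffineHom ψ :=
    GeneratingSections.isAffineHom_toProj (linearSystem z hdef) f fun l => by
      rw [linearSystem_U, lsChart_eq_ZH ι _ _ hM0 hH hcov l]; exact isAffineOpen_ZH ι (hH l) hM0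
  haveI hfin : IsFinite ψ := isFinite_of_isAffineHom_of_comp_eq ψ hψf
  haveI hsurj : Surjective ψ := surjective_of_isFinite_of_dim ψ hXd
  refine ⟨d, ψ, hfin, hsurj, hψf, hXd, ?_⟩
  intro algL hmap
  -- constants go to constants: `k → K(ℙ^d) → K(X)` is `k → K(X)`
  haveI : IsScalarTower k (ProjSpace.P d k).functionField X.functionField :=
    IsScalarTower.of_algebraMap_eq fun c => by
      rw [hmap, RatFn.algebraMap_stalk_apply, RatFn.algebraMap_stalk_apply]
      have h1 : (X ↘ Spec (.of k)).appTop ((Scheme.ΓSpecIso (.of k)).inv c) =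
          ψ.appTop ((Segre.toSpec (Fin (d + 1)) k).appTop ((Scheme.ΓSpecIso (.of k)).inv c)) := by
        rw [show X ↘ Spec (.of k) = f from rfl, ← hψf, Scheme.Hom.comp_appTop]; rfl
      rw [h1]
      exact (functionFieldMap_ofSection ψ (V := ⊤) trivial _).symm
  -- `ψ^♯(y_j/y₀) = z_j/z₀`
  have hu : ∀ j : Fin d, z j.succ / z 0 ∈
      Set.range (algebraMap (ProjSpace.P d k).functionField X.functionField) := fun j => by
    rw [hmap]
    haveI : IsDominant ((linearSystem z hdef).toProj f) := inferInstanceAs (IsDominant ψ)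
    refine ⟨ProjSpace.awayToFunctionField 0 (Segre.frac k 0 j.succ), ?_⟩
    change functionFieldMap ((linearSystem z hdef).toProj f) _ = _
    rw [GeneratingSections.functionFieldMap_toProj_awayToFunctionField_frac (linearSystem z hdef) f
      0 j.succ (genericPoint_mem_lsChart z hz00)]
    exact ofSection_lsRatio z hz00 j.succ
  -- `d(z_j/z₀) = a_j φ(g_j)^{a_j - 1} dφ(g_j)` with `a_j ≠ 0` in `K(X)`: still independent
  haveI : CharP X.functionField p :=
    charP_of_injective_algebraMap (algebraMap k X.functionField).injective p
  have hg0 : ∀ j, dehomFn ι (j₀ ι) (genericPoint_mem_chart_j₀ ι) (g j) ≠ 0 := fun j h =>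
    hli.ne_zero j (show KaehlerDifferential.D k X.functionField
      (dehomFn ι (j₀ ι) (genericPoint_mem_chart_j₀ ι) (g j)) = 0 by rw [h, map_zero])
  have hw : ∀ j, (a j : X.functionField) *
      dehomFn ι (j₀ ι) (genericPoint_mem_chart_j₀ ι) (g j) ^ (a j - 1) ≠ 0 := fun j =>
    mul_ne_zero (by rw [Ne, CharP.cast_eq_zero_iff X.functionField p]; exact hpa j)
      (pow_ne_zero _ (hg0 j))
  have hli' : LinearIndependent X.functionField fun j : Fin d =>
      KaehlerDifferential.D k X.functionField (z j.succ / z 0) := by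
    convert hli.units_smul fun j => Units.mk0 _ (hw j) using 1
    funext j
    rw [Pi.smul_apply', hz0, div_one, hzs, Derivation.leibniz_pow, Units.smul_def, Units.val_mk0,
      mul_smul, Nat.cast_smul_eq_nsmul]
  exact isSeparable_of_linearIndependent hrank _ hu hli'

end SeparableProjection

/-- **STUB A (PROVED, unconditionally): separable projective Noether normalisation over a perfect
field.** For every prime `p`, perfect field `k` of characteristic `p`, and integral closed
`X ⊆ ℙⁿ_k`, there is a finite surjective `k`-morphism `ψ : X → ℙ^d_k` with `d = dim X` along which
`K(X)` is a finite separable extension of `K(ℙ^d)` (`SeparableProjection.separableProjection`: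
forms of high degree prime to `p` chosen by homogeneous prime avoidance with independent
differentials; no use of Kedlaya's theorem). [folklore; cite: Eisenbud1995, Cor. 16.18] -/
theorem stub_separableProjection :
    ∀ (p : ℕ), p.Prime → ∀ (k : Type) [Field k] [CharP k p] [PerfectField k] (n : ℕ)
      (X : AlgebraicGeometry.Scheme.{0}) [AlgebraicGeometry.IsIntegral X]
      (ι : X ⟶ (Literature.AlgebraicGeometry.Motives.projectiveSpace n k).left)
      [AlgebraicGeometry.IsClosedImmersion ι],
      ∃ (d : ℕ) (ψ : X ⟶ Literature.AlgebraicGeometry.Motives.ProjSpace.P d k)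
        (_ : AlgebraicGeometry.IsFinite ψ) (_ : AlgebraicGeometry.Surjective ψ),
        ψ ≫ Literature.AlgebraicGeometry.Motives.Segre.toSpec (Fin (d + 1)) k =
            ι ≫ (Literature.AlgebraicGeometry.Motives.projectiveSpace n k).hom ∧
        topologicalKrullDim X = d ∧
        ∀ [Algebra (Literature.AlgebraicGeometry.Motives.ProjSpace.P d k).functionField
            X.functionField],
          algebraMap (Literature.AlgebraicGeometry.Motives.ProjSpace.P d k).functionField
              X.functionField = Literature.AlgebraicGeometry.Motives.RatFn.functionFieldMap ψ →
          Algebra.IsSeparable (Literature.AlgebraicGeometry.Motives.ProjSpace.P d k).functionField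
              X.functionField ∧
            Module.Finite (Literature.AlgebraicGeometry.Motives.ProjSpace.P d k).functionField
              X.functionField := by
  intro p hp k _ _ _ n X hX ι hι
  exact @SeparableProjection.separableProjection k _ n X hX ι hι p hp _ _

end Summit.ResolutionOfSingularities.ResolutionOfSingularities.Theorems.WeightedThesis.HypersurfaceModel

end
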